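import Summits.Ventures.PercRepro.GenQFlatLatticeO
import Summits.Ventures.PercRepro.GenQFlatLatticeD

/-!
# PercRepro — the flat-lattice counting rows, part P: no flat with more points than the trace lies inside it
(night-4, gen 12)

`NRin(s, r, s′) = 0` for `s < s′`: a flat `F ⊆ H` has `F ∩ G ⊆ H ∩ G`, so its trace has at most `s` points.  The
emitter's (T8) facts sum only over the trace sizes `s ≥ s′` (the LP's variables); this kills the rest.  Imports
`GenQFlatLatticeO`, `GenQFlatLatticeD` (so that the certificate modules reach NEARH through one import).
-/
namespace PercRepro.Night4

open Finset ThmH SixFour GenQ PerFlat Star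

variable {α : Type*} [DecidableEq α] {M : Matroid α} [M.Finite]

/-- `NRin(s, r, s′) = 0` for `s < s′`: a flat inside a trace of `s` points has at most `s` points of `G`. -/
theorem nrInM_eq_zero_of_lt (G : Finset α) {q s s' : ℕ} (hss : s < s') (r : ℕ) : nrInM M G q s r s' = 0 := by
  unfold nrInM
  refine Finset.sum_eq_zero (fun H hH => ?_)
  rw [Finset.card_eq_zero, Finset.filter_eq_empty_iff]
  intro F hF hFH
  have hF' := mem_flatsTr.1 hF
  have hH' := mem_flatsTr.1 hH
  have hsub : F ∩ G ⊆ H ∩ G := Finset.inter_subset_inter hFH (Finset.Subset.refl G)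
  have := Finset.card_le_card hsub
  rw [hF'.2.1, hH'.2.1] at this
  omega

end PercRepro.Night4
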